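import Mathlib
import HarnessLib
import Summits.AtomisticToContinuum.Crystallization.Theorems.PricedLinkCensusSoftFourRingsTypeACell
import Summits.AtomisticToContinuum.Crystallization.Theorems.PricedLinkCensusSoftFourRingsTypeOA
import Summits.AtomisticToContinuum.Crystallization.Theorems.PricedLinkCensusSoftFourRingsBridge

/-!
# Soft four-rings, endgame: point-level type data of a vertex

Support file for `SoftFourRings` (route `PricedLinkCensus`, sub-problem `Crystallization`),
endgame steps (E1)–(E3) of the evidence file (§12.8), in enumeration-free form.  At zero slack
(conditional on Tammes-13) every vertex `v` is of exactly one of two kinds (`type_cases`):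

* **type A** with data `(a, b, c, d)`: `N(v) = {a, b, c, d}`, bonds `a ∼ b ∼ c`, and
  `a ≁ c, a ≁ d, b ≁ d, c ≁ d` (`b` = `α`-partner, `a, c` = wings, `d` = `γ`-partner);
* **type O** with data `(a, b, c, d)`: `N(v) = {a, b, c, d}`, bonds `a ∼ b`, `c ∼ d`, and the
  other four pairs non-bonds.

`typeA_cells` restates the cell lemma `typeA_common_neighbours` for type-A data: the `γ`-partner
`d` has common bonds `x, x' ∉ N[v]` with the wings `a` and `c`, through facets that are not bond
triangles.
-/

namespace Summit.AtomisticToContinuum.Crystallization.Theorems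

open Real RealInnerProductSpace Literature.Geometry.DiscreteGeometry

section Setting

variable {X : Finset (EuclideanSpace ℝ (Fin 3))} {B : Finset (Finset (EuclideanSpace ℝ (Fin 3)))}
  (hT : musinTarasov2012_tammes_thirteen) (hX1 : ∀ y ∈ X, ‖y‖ = 1) (hcard : X.card = 12)
  (hsepX : ∀ u ∈ X, ∀ u' ∈ X, u ≠ u' → ⟪u, u'⟫ ≤ 1 - 1 / (2 * (101 / 100 : ℝ) ^ 2))
  (hB : ∀ T ∈ B, ∃ u ∈ X, ∃ u' ∈ X, u ≠ u' ∧ 1 - (101 / 100 : ℝ) ^ 2 / 2 ≤ ⟪u, u'⟫ ∧ T = {u, u'})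
  (hBcard : B.card = 24)
  (hdeg : ∀ v ∈ X, ∃ w : Fin 4 → EuclideanSpace ℝ (Fin 3), (∀ k, w k ∈ X) ∧
    Function.Injective w ∧ (∀ k, w k ≠ v) ∧
    (∀ k, ({v, w k} : Finset (EuclideanSpace ℝ (Fin 3))) ∈ B) ∧
    ∀ y, ({v, y} : Finset (EuclideanSpace ℝ (Fin 3))) ∈ B → ∃ k, y = w k)

/-- Images of index pairs. -/
theorem image_pair_eq {w : Fin 4 → EuclideanSpace ℝ (Fin 3)} {a b i j : Fin 4}
    (h : ({a, b} : Finset (Fin 4)) = {i, j}) :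
    ({w a, w b} : Finset (EuclideanSpace ℝ (Fin 3))) = {w i, w j} := by
  classical
  have : ∀ p q : Fin 4, ({w p, w q} : Finset (EuclideanSpace ℝ (Fin 3))) =
      (({p, q} : Finset (Fin 4)).image w) := fun p q => by
    rw [Finset.image_insert, Finset.image_singleton]
  rw [this, this, h]

include hT hX1 hcard hsepX hB hBcard hdeg in
open scoped Classical in
/-- **Every vertex is of type A or of type O** (see the module docstring). -/
theorem type_cases {v : EuclideanSpace ℝ (Fin 3)} (hv : v ∈ X) :
    (∃ a b c d : EuclideanSpace ℝ (Fin 3),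
      (∀ y, ({v, y} : Finset (EuclideanSpace ℝ (Fin 3))) ∈ B ↔ (y = a ∨ y = b ∨ y = c ∨ y = d)) ∧
      (a ≠ b ∧ a ≠ c ∧ a ≠ d ∧ b ≠ c ∧ b ≠ d ∧ c ≠ d) ∧
      ({a, b} : Finset (EuclideanSpace ℝ (Fin 3))) ∈ B ∧
      ({b, c} : Finset (EuclideanSpace ℝ (Fin 3))) ∈ B ∧
      ({a, c} : Finset (EuclideanSpace ℝ (Fin 3))) ∉ B ∧
      ({a, d} : Finset (EuclideanSpace ℝ (Fin 3))) ∉ B ∧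
      ({b, d} : Finset (EuclideanSpace ℝ (Fin 3))) ∉ B ∧
      ({c, d} : Finset (EuclideanSpace ℝ (Fin 3))) ∉ B) ∨
    (∃ a b c d : EuclideanSpace ℝ (Fin 3),
      (∀ y, ({v, y} : Finset (EuclideanSpace ℝ (Fin 3))) ∈ B ↔ (y = a ∨ y = b ∨ y = c ∨ y = d)) ∧
      (a ≠ b ∧ a ≠ c ∧ a ≠ d ∧ b ≠ c ∧ b ≠ d ∧ c ≠ d) ∧
      ({a, b} : Finset (EuclideanSpace ℝ (Fin 3))) ∈ B ∧
      ({c, d} : Finset (EuclideanSpace ℝ (Fin 3))) ∈ B ∧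
      ({a, c} : Finset (EuclideanSpace ℝ (Fin 3))) ∉ B ∧
      ({a, d} : Finset (EuclideanSpace ℝ (Fin 3))) ∉ B ∧
      ({b, c} : Finset (EuclideanSpace ℝ (Fin 3))) ∉ B ∧
      ({b, d} : Finset (EuclideanSpace ℝ (Fin 3))) ∉ B) := by
  obtain ⟨h0, -⟩ := hull_counts_of_twelve hT hX1 hcard hsepX hB hBcard
  obtain ⟨-, ht2⟩ := no_slack_one_percent hT hX1 hcard hsepX hB hBcard hdeg
  obtain ⟨w, hwX, hwinj, hwv, hvw, hvonly⟩ := hdeg v hv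
  obtain ⟨i₁, j₁, i₂, j₂, h₁, h₂, hne, hB₁, hB₂, hall⟩ :=
    bondedPairs_of_two_bondTriangles_at hX1 h0 hsepX hB hv w hwX hwinj hwv hvw hvonly (ht2 v hv)
  obtain ⟨i, j, k, l, hnd, hp, hq⟩ := fin_four_pairs_dichotomy h₁ h₂ hne
  have hnd' : (i ≠ j ∧ i ≠ k ∧ i ≠ l) ∧ (j ≠ k ∧ j ≠ l) ∧ k ≠ l := by
    simp only [List.nodup_cons, List.mem_cons, not_or, List.not_mem_nil,
      not_false_eq_true, and_true, List.nodup_nil] at hnd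
    exact hnd
  have hN : ∀ y, ({v, y} : Finset (EuclideanSpace ℝ (Fin 3))) ∈ B ↔
      (y = w i ∨ y = w j ∨ y = w k ∨ y = w l) := by
    intro y
    constructor
    · intro hy
      obtain ⟨m, rfl⟩ := hvonly y hy
      rcases fin_four_eq_of_nodup i j k l hnd m with rfl | rfl | rfl | rfl
      · exact Or.inl rfl
      · exact Or.inr (Or.inl rfl)
      · exact Or.inr (Or.inr (Or.inl rfl))
      · exact Or.inr (Or.inr (Or.inr rfl))
    · rintro (rfl | rfl | rfl | rfl) <;> exact hvw _
  have hdist : w i ≠ w j ∧ w i ≠ w k ∧ w i ≠ w l ∧ w j ≠ w k ∧ w j ≠ w l ∧ w k ≠ w l :=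
    ⟨fun h => hnd'.1.1 (hwinj h), fun h => hnd'.1.2.1 (hwinj h), fun h => hnd'.1.2.2 (hwinj h),
      fun h => hnd'.2.1.1 (hwinj h), fun h => hnd'.2.1.2 (hwinj h), fun h => hnd'.2.2 (hwinj h)⟩
  have hBij : ({w i, w j} : Finset (EuclideanSpace ℝ (Fin 3))) ∈ B := by
    rw [← image_pair_eq hp]; exact hB₁
  -- a non-bond test: a bonded pair `{w a, w b}` has index pair `{i₁, j₁}` or `{i₂, j₂}`
  have hnb : ∀ a b : Fin 4, a ≠ b → ({a, b} : Finset (Fin 4)) ≠ {i₁, j₁} →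
      ({a, b} : Finset (Fin 4)) ≠ {i₂, j₂} →
      ({w a, w b} : Finset (EuclideanSpace ℝ (Fin 3))) ∉ B := by
    intro a b hab h1 h2 hBab
    rcases hall a b hab hBab with h | h
    · exact h1 h
    · exact h2 h
  -- index-pair inequalities from `Nodup`
  have hpne : ∀ {a b c d : Fin 4}, (a ≠ c ∧ a ≠ d) ∨ (b ≠ c ∧ b ≠ d) →
      ({a, b} : Finset (Fin 4)) ≠ {c, d} := by
    intro a b c d h he
    rcases finset_pair_eq_pair_iff.1 he with ⟨rfl, rfl⟩ | ⟨rfl, rfl⟩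
    · rcases h with ⟨h1, -⟩ | ⟨-, h2⟩
      · exact h1 rfl
      · exact h2 rfl
    · rcases h with ⟨-, h1⟩ | ⟨h2, -⟩
      · exact h1 rfl
      · exact h2 rfl
  rcases hq with hq | hq
  · -- type O: pairs `{i, j}` and `{k, l}`
    right
    have hBkl : ({w k, w l} : Finset (EuclideanSpace ℝ (Fin 3))) ∈ B := by
      rw [← image_pair_eq hq]; exact hB₂
    refine ⟨w i, w j, w k, w l, hN, hdist, hBij, hBkl, ?_, ?_, ?_, ?_⟩
    · refine hnb i k hnd'.1.2.1 (hp ▸ hpne ?_) (hq ▸ hpne ?_)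
      · exact Or.inr ⟨hnd'.1.2.1.symm, hnd'.2.1.1.symm⟩
      · exact Or.inl ⟨hnd'.1.2.1, hnd'.1.2.2⟩
    · refine hnb i l hnd'.1.2.2 (hp ▸ hpne ?_) (hq ▸ hpne ?_)
      · exact Or.inr ⟨hnd'.1.2.2.symm, hnd'.2.1.2.symm⟩
      · exact Or.inl ⟨hnd'.1.2.1, hnd'.1.2.2⟩
    · refine hnb j k hnd'.2.1.1 (hp ▸ hpne ?_) (hq ▸ hpne ?_)
      · exact Or.inr ⟨hnd'.1.2.1.symm, hnd'.2.1.1.symm⟩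
      · exact Or.inl ⟨hnd'.2.1.1, hnd'.2.1.2⟩
    · refine hnb j l hnd'.2.1.2 (hp ▸ hpne ?_) (hq ▸ hpne ?_)
      · exact Or.inr ⟨hnd'.1.2.2.symm, hnd'.2.1.2.symm⟩
      · exact Or.inl ⟨hnd'.2.1.1, hnd'.2.1.2⟩
  · -- type A: pairs `{i, j}` and `{j, k}`
    left
    have hBjk : ({w j, w k} : Finset (EuclideanSpace ℝ (Fin 3))) ∈ B := by
      rw [← image_pair_eq hq]; exact hB₂
    refine ⟨w i, w j, w k, w l, hN, hdist, hBij, hBjk, ?_, ?_, ?_, ?_⟩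
    · refine hnb i k hnd'.1.2.1 (hp ▸ hpne ?_) (hq ▸ hpne ?_)
      · exact Or.inr ⟨hnd'.1.2.1.symm, hnd'.2.1.1.symm⟩
      · exact Or.inl ⟨hnd'.1.1, hnd'.1.2.1⟩
    · refine hnb i l hnd'.1.2.2 (hp ▸ hpne ?_) (hq ▸ hpne ?_)
      · exact Or.inr ⟨hnd'.1.2.2.symm, hnd'.2.1.2.symm⟩
      · exact Or.inl ⟨hnd'.1.1, hnd'.1.2.1⟩
    · refine hnb j l hnd'.2.1.2 (hp ▸ hpne ?_) (hq ▸ hpne ?_)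
      · exact Or.inr ⟨hnd'.1.2.2.symm, hnd'.2.1.2.symm⟩
      · exact Or.inr ⟨hnd'.2.1.2.symm, hnd'.2.2.symm⟩
    · refine hnb k l hnd'.2.2 (hp ▸ hpne ?_) (hq ▸ hpne ?_)
      · exact Or.inl ⟨hnd'.1.2.1.symm, hnd'.2.1.1.symm⟩
      · exact Or.inr ⟨hnd'.2.1.2.symm, hnd'.2.2.symm⟩

include hT hX1 hcard hsepX hB hBcard hdeg in
open scoped Classical in
/-- **The cells at a type-A vertex, point form**: with type-A data `(a, b, c, d)` at `v`, the
`γ`-partner `d` has a common bond `x ∉ N[v]` with the wing `a` and a common bond `x' ∉ N[v]`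
with the wing `c`, through facets `{x, d} ⊆ f`, `{x', d} ⊆ f'` that are not bond triangles. -/
theorem typeA_cells {v a b c d : EuclideanSpace ℝ (Fin 3)} (hv : v ∈ X)
    (hN : ∀ y, ({v, y} : Finset (EuclideanSpace ℝ (Fin 3))) ∈ B ↔ (y = a ∨ y = b ∨ y = c ∨ y = d))
    (hd : a ≠ b ∧ a ≠ c ∧ a ≠ d ∧ b ≠ c ∧ b ≠ d ∧ c ≠ d)
    (hab : ({a, b} : Finset (EuclideanSpace ℝ (Fin 3))) ∈ B)
    (hbc : ({b, c} : Finset (EuclideanSpace ℝ (Fin 3))) ∈ B)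
    (hac : ({a, c} : Finset (EuclideanSpace ℝ (Fin 3))) ∉ B)
    (had : ({a, d} : Finset (EuclideanSpace ℝ (Fin 3))) ∉ B)
    (hbd : ({b, d} : Finset (EuclideanSpace ℝ (Fin 3))) ∉ B)
    (hcd : ({c, d} : Finset (EuclideanSpace ℝ (Fin 3))) ∉ B) :
    (∃ x ∈ X, x ≠ v ∧ x ≠ a ∧ x ≠ b ∧ x ≠ c ∧ x ≠ d ∧
      ({x, d} : Finset (EuclideanSpace ℝ (Fin 3))) ∈ B ∧
      ({x, a} : Finset (EuclideanSpace ℝ (Fin 3))) ∈ B ∧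
      ∃ c₀ ∈ facetNormals X, x ∈ tightSet X c₀ ∧ d ∈ tightSet X c₀ ∧
        ¬ ((tightSet X c₀).card = 3 ∧ ((edgesOfFacet X c₀).filter (fun T => T ∉ B)).card = 0)) ∧
    (∃ x ∈ X, x ≠ v ∧ x ≠ a ∧ x ≠ b ∧ x ≠ c ∧ x ≠ d ∧
      ({x, d} : Finset (EuclideanSpace ℝ (Fin 3))) ∈ B ∧
      ({x, c} : Finset (EuclideanSpace ℝ (Fin 3))) ∈ B ∧
      ∃ c₀ ∈ facetNormals X, x ∈ tightSet X c₀ ∧ d ∈ tightSet X c₀ ∧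
        ¬ ((tightSet X c₀).card = 3 ∧ ((edgesOfFacet X c₀).filter (fun T => T ∉ B)).card = 0)) := by
  obtain ⟨hab', hac', had', hbc', hbd', hcd'⟩ := hd
  set w : Fin 4 → EuclideanSpace ℝ (Fin 3) := ![a, b, c, d] with hw
  have hw0 : w 0 = a := rfl
  have hw1 : w 1 = b := rfl
  have hw2 : w 2 = c := rfl
  have hw3 : w 3 = d := rfl
  have hwinj : Function.Injective w := injective_vec4 hab' hac' had' hbc' hbd' hcd'
  have hvw : ∀ k, ({v, w k} : Finset (EuclideanSpace ℝ (Fin 3))) ∈ B := by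
    intro k
    fin_cases k
    · exact (hN a).2 (Or.inl rfl)
    · exact (hN b).2 (Or.inr (Or.inl rfl))
    · exact (hN c).2 (Or.inr (Or.inr (Or.inl rfl)))
    · exact (hN d).2 (Or.inr (Or.inr (Or.inr rfl)))
  have hwX : ∀ k, w k ∈ X := fun k => (mem_of_mem_bonds hB (hvw k)).2
  have hwv : ∀ k, w k ≠ v := fun k => (ne_of_mem_bonds hB (hvw k)).symm
  have hvonly : ∀ y, ({v, y} : Finset (EuclideanSpace ℝ (Fin 3))) ∈ B → ∃ k, y = w k := by
    intro y hy
    rw [exists_fin_four_iff]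
    exact (hN y).1 hy
  have hnd : [(0 : Fin 4), 1, 2, 3].Nodup := by decide
  have hBij : ({w 0, w 1} : Finset (EuclideanSpace ℝ (Fin 3))) ∈ B := hab
  have hBjk : ({w 1, w 2} : Finset (EuclideanSpace ℝ (Fin 3))) ∈ B := hbc
  have hNB : ∀ p q : Fin 4, p ≠ q → ({w p, w q} : Finset (EuclideanSpace ℝ (Fin 3))) ∈ B →
      ({p, q} : Finset (Fin 4)) = {0, 1} ∨ ({p, q} : Finset (Fin 4)) = {1, 2} := by
    intro p q _ hBpq
    fin_cases p <;> fin_cases q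
    all_goals
      simp only [hw, Fin.zero_eta, Fin.mk_one, Fin.isValue, Fin.reduceFinMk,
        Matrix.cons_val_zero, Matrix.cons_val_one, Matrix.cons_val] at hBpq
    all_goals first
      | (left; decide)
      | (right; decide)
      | (exfalso; exact (ne_of_mem_bonds hB hBpq) rfl)
      | (exfalso; exact hac hBpq)
      | (exfalso; exact had hBpq)
      | (exfalso; exact hbd hBpq)
      | (exfalso; exact hcd hBpq)
      | (exfalso; rw [Finset.pair_comm] at hBpq; exact hac hBpq)
      | (exfalso; rw [Finset.pair_comm] at hBpq; exact had hBpq)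
      | (exfalso; rw [Finset.pair_comm] at hBpq; exact hbd hBpq)
      | (exfalso; rw [Finset.pair_comm] at hBpq; exact hcd hBpq)
  obtain ⟨⟨x, hxX, hxv, hxw, hBxl, hBxi, hf⟩, ⟨x', hx'X, hx'v, hx'w, hBx'l, hBx'k, hf'⟩⟩ :=
    typeA_common_neighbours hT hX1 hcard hsepX hB hBcard hdeg hv w hwX hwinj hwv hvw hvonly hnd
      hBij hBjk hNB (i := 0) (j := 1) (k := 2) (l := 3)
  exact ⟨⟨x, hxX, hxv, hxw 0, hxw 1, hxw 2, hxw 3, hBxl, hBxi, hf⟩,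
    ⟨x', hx'X, hx'v, hx'w 0, hx'w 1, hx'w 2, hx'w 3, hBx'l, hBx'k, hf'⟩⟩

end Setting

end Summit.AtomisticToContinuum.Crystallization.Theorems
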